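import Summits.FinalStateConjecture.FinalStateConjecture.Theorems.EIHFluxBalanceInertialRecessionStubHigherOrderAnsatzField

/-!
# Route EIHFluxBalance — `InertialRecession` (E′), line `SketchCleanExcision`, skeleton r13,
# stub `stub_higherOrderSlaving` (EF): the lab-time variations of the frozen ansatz are symmetric
# forms

Helper file for the crux `stmt-FinalStateConjecture-17403`
(`Summit.FinalStateConjecture.FinalStateConjecture.Theses.EIHFluxBalance.InertialRecession`, E′),
registered stub `stub_higherOrderSlaving` (orders two and three of frozen-vacuum slaving).

* `higherOrder_iteratedDeriv_symm` — iterated derivatives of a `Cᵏ` path of symmetric bilinear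
  forms are symmetric (evaluation commutes with iterated derivatives,
  `ContinuousLinearMap.iteratedFDeriv_comp_left`);
* `higherOrder_variation_symm` — hence the lab-time variation fields `P_m = ∂ₛᵐΦ(t, ·)` of the
  two-variable frozen ansatz (`…StubHigherOrderAnsatzField`) are symmetric at every point where
  all painted radii are positive — the symmetry required of the comparison fields
  `G ∓ (x⁰ − t)ᵐ/m! • P_m` in the higher-order slaving steps (`…StubHigherOrderApplyCB`).

No definitions, no named facts, no `sorry`.
-/

set_option linter.dupNamespace false
set_option maxSynthPendingDepth 6

noncomputable section

namespace Summit.FinalStateConjecture.FinalStateConjecture.Theorems.SublinearIsFree.Slaving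

open scoped Topology ContDiff BigOperators
open Filter Set Function Literature.Geometry.Lorentzian
  Summit.FinalStateConjecture.FinalStateConjecture.Theorems

/-- **Iterated derivatives of a `Cᵏ` path of symmetric forms are symmetric.** [folklore] -/
theorem higherOrder_iteratedDeriv_symm {F : ℝ → E4 →L[ℝ] E4 →L[ℝ] ℝ} (hF : ∀ s u v, F s u v = F s v u)
    {k : ℕ} {t : ℝ} (hFc : ContDiffAt ℝ k F t) (u v : E4) :
    iteratedDeriv k F t u v = iteratedDeriv k F t v u := by
  set φ₁ : (E4 →L[ℝ] E4 →L[ℝ] ℝ) →L[ℝ] ℝ :=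
    (ContinuousLinearMap.apply ℝ ℝ v).comp (ContinuousLinearMap.apply ℝ (E4 →L[ℝ] ℝ) u) with hφ₁
  set φ₂ : (E4 →L[ℝ] E4 →L[ℝ] ℝ) →L[ℝ] ℝ :=
    (ContinuousLinearMap.apply ℝ ℝ u).comp (ContinuousLinearMap.apply ℝ (E4 →L[ℝ] ℝ) v) with hφ₂
  have hφ₁a : ∀ T : E4 →L[ℝ] E4 →L[ℝ] ℝ, φ₁ T = T u v := fun T ↦ rfl
  have hφ₂a : ∀ T : E4 →L[ℝ] E4 →L[ℝ] ℝ, φ₂ T = T v u := fun T ↦ rfl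
  have hφF : (φ₁ ∘ F) = (φ₂ ∘ F) := by
    funext s; rw [Function.comp_apply, Function.comp_apply, hφ₁a, hφ₂a, hF]
  have hc₁ := ContinuousLinearMap.iteratedFDeriv_comp_left φ₁ hFc (i := k) le_rfl
  have hc₂ := ContinuousLinearMap.iteratedFDeriv_comp_left φ₂ hFc (i := k) le_rfl
  rw [hφF, hc₂] at hc₁
  have h := congrArg (fun m : ContinuousMultilinearMap ℝ (fun _ : Fin k ↦ ℝ) ℝ ↦ m fun _ ↦ 1) hc₁
  simp only [ContinuousLinearMap.compContinuousMultilinearMap_coe, Function.comp_apply] at h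
  rw [iteratedDeriv_eq_iteratedFDeriv, ← hφ₁a, ← hφ₂a]
  exact h.symm

/-- **The lab-time variations of the frozen ansatz are symmetric forms** where all painted radii
are positive. [folklore] -/
theorem higherOrder_variation_symm (N : ℕ) (M a : Fin N → ℝ) (Λ : Fin N → ℝ → lorentzGroup)
    (ξ : Fin N → ℝ → E3)
    (hΛ : ∀ i, ContDiff ℝ ∞ (fun t ↦ ((Λ i t : E4 ≃L[ℝ] E4) : E4 →L[ℝ] E4))) (hξ : ∀ i, ContDiff ℝ ∞ (ξ i))
    {t : ℝ} {z : E4} (hz : ∀ i, 0 < Kerr.radius (a i) (poincareInv (Λ i t) (E4.ofTimeSpace t (ξ i t)) z))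
    (k : ℕ) (u v : E4) :
    iteratedDeriv k (fun s ↦ (fun q : ℝ × E4 ↦ Minkowski.bilin + ∑ i, (boostedKerrBilin (Λ i q.1)
      (E4.ofTimeSpace q.1 (ξ i q.1)) (M i) (a i) q.2 - Minkowski.bilin)) (s, z)) t u v =
    iteratedDeriv k (fun s ↦ (fun q : ℝ × E4 ↦ Minkowski.bilin + ∑ i, (boostedKerrBilin (Λ i q.1)
      (E4.ofTimeSpace q.1 (ξ i q.1)) (M i) (a i) q.2 - Minkowski.bilin)) (s, z)) t v u := by
  obtain ⟨hUo, hΦ⟩ := higherOrder_contDiffOn_ansatzField N M a Λ ξ hΛ hξ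
  have hc : ContDiffAt ℝ k (fun s ↦ (fun q : ℝ × E4 ↦ Minkowski.bilin + ∑ i, (boostedKerrBilin (Λ i q.1)
      (E4.ofTimeSpace q.1 (ξ i q.1)) (M i) (a i) q.2 - Minkowski.bilin)) (s, z)) t :=
    ((hΦ.contDiffAt (hUo.mem_nhds (x := (t, z)) hz)).comp t (contDiff_prodMk_left z).contDiffAt).of_le
      (by exact_mod_cast le_top)
  refine higherOrder_iteratedDeriv_symm (fun s u v ↦ ?_) hc u v
  simp only [_root_.add_apply, FunLike.coe_sum, Finset.sum_apply, _root_.sub_apply,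
    Minkowski.bilin_symm u v, boostedKerrBilin_symm _ _ _ _ z u v]

/-- **Registered one-line carrier form** (`higherOrder_variationSymm_EF`) of
`higherOrder_variation_symm`. [folklore] -/
theorem higherOrder_variationSymm_EF : open Literature.Geometry.Lorentzian in ∀ (N : ℕ) (M a : Fin N → ℝ) (Λ : Fin N → ℝ → lorentzGroup) (ξ : Fin N → ℝ → E3), (∀ i, ContDiff ℝ ((⊤ : ℕ∞) : WithTop ℕ∞) (fun t ↦ ((Λ i t : E4 ≃L[ℝ] E4) : E4 →L[ℝ] E4))) → (∀ i, ContDiff ℝ ((⊤ : ℕ∞) : WithTop ℕ∞) (ξ i)) → ∀ {t : ℝ} {z : E4}, (∀ i, 0 < Kerr.radius (a i) (poincareInv (Λ i t) (E4.ofTimeSpace t (ξ i t)) z)) → ∀ (k : ℕ) (u v : E4), iteratedDeriv k (fun s ↦ (fun q : ℝ × E4 ↦ Minkowski.bilin + ∑ i, (boostedKerrBilin (Λ i q.1) (E4.ofTimeSpace q.1 (ξ i q.1)) (M i) (a i) q.2 - Minkowski.bilin)) (s, z)) t u v = iteratedDeriv k (fun s ↦ (fun q : ℝ × E4 ↦ Minkowski.bilin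 + ∑ i, (boostedKerrBilin (Λ i q.1) (E4.ofTimeSpace q.1 (ξ i q.1)) (M i) (a i) q.2 - Minkowski.bilin)) (s, z)) t v u :=
  fun N M a Λ ξ hΛ hξ _ _ hz k u v ↦ higherOrder_variation_symm N M a Λ ξ hΛ hξ hz k u v

end Summit.FinalStateConjecture.FinalStateConjecture.Theorems.SublinearIsFree.Slaving

end
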